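import Literature.AlgebraicGeometry.Frobenioids.Thm42SubAssemblyIIandIII
import HarnessLib

/-!
# Frobenioids I, Theorem 4.2 (ii) AS TYPED (`PreFrobenioidData.Thm42ii`) for arbitrary Frobenioids over
# bases of FSM-type — modulo only "`C^pf` is a Frobenioid"

Mochizuki, *The geometry of Frobenioids I: the general theory*, Kyushu J. Math. **62** (2008)
293–400, Thm. 4.2 (ii), kurims text pp. 77–78, proof p. 80 ll. 18–33 [cite: MochizukiFrdI2008, Thm. 4.2 (ii) p.77]:
"the equivalence of categories `Ψ` induces a bijection `Ψ^Prime(A₁) : Prime(Φ₁(A₁)) ⥲ Prime(Φ₂(A₂))` …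
[via] the primary steps to / from `A_i` … [which] `Ψ` preserves [by (i)]".

PROOF-ONLY file (seat abc-iut-w4-d090, Thm. 4.2 closeout, L1-lead R81 (4)). The cell's kernel proof of the
family `Ψ^Prime` (`PreFrobenioid.existsUnique_primesEquiv_family`, seat abc-iut-L1-t14,
`PrimesEquivalence.lean`) is stated for Frobenioids of PERFECT type, but perfectness enters its proof at a
single point — the transport of the primary composite `φ ∘ ε` through Prop. 4.1 (ii)
(`isPrimaryPreStep_comp_map`) — which is unnecessary once `Ψ` is known to preserve ALL primary pre-steps
(Thm. 4.2 (i), now a theorem of the cell modulo "`C^pf` is a Frobenioid":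
`FrdI.T42.thm42i_of_isOfFSMType_of_perfection`). Hence:

* `PreFrobenioid.existsUnique_primesEquiv_family'` — seat abc-iut-L1-t14's theorem and proof VERBATIM but
  for the hypotheses `IsOfPerfectType F`, `IsOfPerfectType F₂` (and the then idle "`Ψ⁻¹` preserves steps")
  dropped and the one call to `isPrimaryPreStep_comp_map` replaced by `hprim (ε ≫ φ)` (credit: abc-iut-L1-t14);
* `FrdI.T42.thm42Setting_symm` — the typed hypotheses are symmetric in `(C₁, C₂)`;
* `FrdI.T42.thm42ii_ofFunctor_of_isOfFSMType_of_perfection` — **Thm. 4.2 (ii) as typed** for Frobenioids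
  with `Φ_i` perf-factorial over bases of FSM-type, GIVEN `hPf_i : IsFrobenioid (Perfection.ops hF_i).toFunctor`
  (cone node Prop. 3.2 (iii); the cell's standing named hypothesis, not dressed as a fact): steps and
  pre-steps by Thm. 3.4 (ii) (seat abc-iut-L1-t13), primary pre-steps along `Ψ` and `Ψ⁻¹` by Thm. 4.2 (i)
  through the perfections.

No new definitions; no statement of the paper is strengthened.
-/

namespace Literature.AlgebraicGeometry.Frobenioids

open CategoryTheory Opposite

namespace PreFrobenioid

universe w v v' u u' w₂ v₂ v₂' u₂ u₂'

variable {D : Type u} [Category.{v} D] {Φ : Dᵒᵖ ⥤ CommMonCat.{w}}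
  {C : Type u'} [Category.{v'} C] {F : C ⥤ ElemFrobenioid Φ}

variable {D₂ : Type u₂} [Category.{v₂} D₂] {Φ₂ : D₂ᵒᵖ ⥤ CommMonCat.{w₂}}
  {C₂ : Type u₂'} [Category.{v₂'} C₂] {F₂ : C₂ ⥤ ElemFrobenioid Φ₂} (Ψ : C ≌ C₂)

set_option backward.isDefEq.respectTransparency false in
/-- **Theorem 4.2 (ii), the family `Ψ^Prime`, WITHOUT the perfect-type hypothesis** (FrdI pp. 77–80): for
Frobenioids of isotropic type with perf-factorial divisor monoids and an equivalence `Ψ` such that `Ψ`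
preserves steps and `Ψ`, `Ψ⁻¹` preserve pre-steps and primary pre-steps (Thm. 3.4 (ii), Thm. 4.2 (i)), there
is a UNIQUE
family of bijections `e A : Prime(Φ₁(A)) ≃ Prime(Φ₂(Ψ A))` with, for every `𝔭 ∈ Prime(Φ₁(A))`:
(a) for every co-angular pre-step `φ : A → B`, `Div(φ) ∈ Φ₁(A)_𝔭 ⟺ Div(Ψ φ) ∈ Φ₂(Ψ A)_{e A 𝔭}`;
(b) for every co-angular pre-step `ψ : B → A`, `ψ_*Div(ψ) ∈ Φ₁(A)_𝔭 ⟺ Ψ(ψ)_*Div(Ψ ψ) ∈ Φ₂(Ψ A)_{e A 𝔭}`.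
Statement and proof are seat abc-iut-L1-t14's `existsUnique_primesEquiv_family` (`PrimesEquivalence.lean`)
with the perfect-type hypotheses removed: the primary composite `ε ≫ φ` is carried to a primary pre-step by
`hprim` itself instead of Prop. 4.1 (ii). [cite: MochizukiFrdI2008, Thm. 4.2 (ii) p.77] -/
theorem existsUnique_primesEquiv_family' (hF : IsFrobenioid F) (hF₂ : IsFrobenioid F₂)
    (histr : IsOfIsotropicType F) (histr₂ : IsOfIsotropicType F₂)
    (hpf : Objectwise (fun M _ => IsPerfFactorial M) Φ)
    (hpf₂ : Objectwise (fun M _ => IsPerfFactorial M) Φ₂)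
    (hstep : ∀ ⦃X Y : C⦄ (φ : X ⟶ Y), IsStep F φ → IsStep F₂ (Ψ.functor.map φ))
    (hpre : ∀ ⦃X Y : C⦄ (φ : X ⟶ Y), IsPreStep F φ → IsPreStep F₂ (Ψ.functor.map φ))
    (hpre' : ∀ ⦃X Y : C₂⦄ (φ : X ⟶ Y), IsPreStep F₂ φ → IsPreStep F (Ψ.inverse.map φ))
    (hprim : ∀ ⦃X Y : C⦄ (φ : X ⟶ Y), IsPrimaryPreStep F φ → IsPrimaryPreStep F₂ (Ψ.functor.map φ))
    (hprim' : ∀ ⦃X Y : C₂⦄ (φ : X ⟶ Y), IsPrimaryPreStep F₂ φ → IsPrimaryPreStep F (Ψ.inverse.map φ)) :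
    ∃! e : ∀ A : C, Primes (Φ.obj (op (baseObj F A))) ≃ Primes (Φ₂.obj (op (baseObj F₂ (Ψ.functor.obj A)))),
      ∀ (A : C) (𝔭 : Primes (Φ.obj (op (baseObj F A)))),
        (∀ ⦃B : C⦄ (φ : A ⟶ B), IsCoAngularPreStep F φ →
            (Div F φ ∈ 𝔭.submonoid ↔ Div F₂ (Ψ.functor.map φ) ∈ (e A 𝔭).submonoid)) ∧
        ∀ ⦃B : C⦄ (ψ : B ⟶ A), IsCoAngularPreStep F ψ →
          ((∃ y ∈ 𝔭.submonoid, pull Φ (Base F ψ) y = Div F ψ) ↔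
            ∃ y ∈ (e A 𝔭).submonoid,
              pull Φ₂ (Base F₂ (Ψ.functor.map ψ)) y = Div F₂ (Ψ.functor.map ψ)) := by
  have hP := hF.isPreFrobenioid
  have hP₂ := hF₂.isPreFrobenioid
  have H := fun A : C => existsUnique_primesEquiv Ψ hF hF₂ histr histr₂ hpf hpf₂ hpre hpre' A
    (fun E ε hε => hprim ε hε) (fun Z ξ hξ => hprim' ξ hξ)
  choose e he using fun A => (H A).exists
  -- (b'): the characteristic property, for an arbitrary co-angular pre-step into `A`
  have clauseB : ∀ (A : C) (𝔭 : Primes (Φ.obj (op (baseObj F A)))) ⦃B : C⦄ (ψ : B ⟶ A),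
      IsCoAngularPreStep F ψ →
        ((∃ y ∈ 𝔭.submonoid, pull Φ (Base F ψ) y = Div F ψ) ↔
          ∃ y ∈ (e A 𝔭).submonoid,
            pull Φ₂ (Base F₂ (Ψ.functor.map ψ)) y = Div F₂ (Ψ.functor.map ψ)) := by
    intro A 𝔭 B ψ hψ
    haveI : IsIso (Base F ψ) := hψ.2.2
    have hΨψ : IsPreStep F₂ (Ψ.functor.map ψ) := hpre ψ hψ.2
    haveI : IsIso (Base F₂ (Ψ.functor.map ψ)) := hΨψ.2
    by_cases hiso : IsIso ψ
    · -- both sides hold with `y = 0`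
      refine ⟨fun _ => ⟨1, one_mem _, ?_⟩, fun _ => ⟨1, one_mem _, ?_⟩⟩
      · rw [map_one]; exact (isIsometry_of_isIso F₂ hP₂ (Ψ.functor.map ψ)).symm
      · rw [map_one]; exact (isIsometry_of_isIso F hP ψ).symm
    · have hst : IsStep F ψ := ⟨hψ.2, hiso⟩
      have hst₂ : IsStep F₂ (Ψ.functor.map ψ) := hstep ψ hst
      -- both sides say: `x_ψ` resp. `x_{Ψ ψ}` lies in the prime
      have hL : (∃ y ∈ 𝔭.submonoid, pull Φ (Base F ψ) y = Div F ψ) ↔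
          invDiv F ψ hψ.2.2 ∈ 𝔭.carrier := by
        constructor
        · rintro ⟨y, hy, hyx⟩
          have hy' : y = invDiv F ψ hψ.2.2 :=
            pull_injective_of_isIso Φ (Base F ψ) (by rw [hyx, pull_invDiv])
          rcases (𝔭.mem_submonoid_iff' y).mp hy with h1 | h1
          · exact absurd (by rw [← hyx, h1, map_one]) (div_ne_one_of_isStep histr hst)
          · exact hy' ▸ h1
        · exact fun h => ⟨_, Submonoid.subset_closure h, pull_invDiv ψ hψ.2.2⟩
      have hR : (∃ y ∈ (e A 𝔭).submonoid,
            pull Φ₂ (Base F₂ (Ψ.functor.map ψ)) y = Div F₂ (Ψ.functor.map ψ)) ↔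
          invDiv F₂ (Ψ.functor.map ψ) hΨψ.2 ∈ (e A 𝔭).carrier := by
        constructor
        · rintro ⟨y, hy, hyx⟩
          have hy' : y = invDiv F₂ (Ψ.functor.map ψ) hΨψ.2 :=
            pull_injective_of_isIso Φ₂ (Base F₂ (Ψ.functor.map ψ)) (by rw [hyx, pull_invDiv])
          rcases ((e A 𝔭).mem_submonoid_iff' y).mp hy with h1 | h1
          · exact absurd (by rw [← hyx, h1, map_one]) (div_ne_one_of_isStep histr₂ hst₂)
          · exact hy' ▸ h1
        · exact fun h => ⟨_, Submonoid.subset_closure h, pull_invDiv _ hΨψ.2⟩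
      rw [hL, hR]
      constructor
      · intro h
        exact he A ψ (isPrimaryPreStep_of_isPrimary_invDiv hψ.2 h.1) 𝔭 h
      · intro h
        have hprimψ : IsPrimaryPreStep F ψ :=
          isPrimaryPreStep_of_map Ψ hP hprim' (isPrimaryPreStep_of_isPrimary_invDiv hΨψ h.1)
        let 𝔮 : Primes (Φ.obj (op (baseObj F A))) := Quotient.mk _ ⟨_, isPrimary_invDiv hprimψ⟩
        have hq : invDiv F ψ hψ.2.2 ∈ 𝔮.carrier := mem_carrier_mk_of_isPrimary _
        have h2 := he A ψ hprimψ 𝔮 hq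
        have h3 : e A 𝔮 = e A 𝔭 := Primes.eq_of_mem_carrier h2 h
        rwa [(e A).injective h3] at hq
  -- (a): co-angular pre-steps out of `A`
  have clauseA : ∀ (A : C) (𝔭 : Primes (Φ.obj (op (baseObj F A)))) ⦃B : C⦄ (φ : A ⟶ B),
      IsCoAngularPreStep F φ →
        (Div F φ ∈ 𝔭.submonoid ↔ Div F₂ (Ψ.functor.map φ) ∈ (e A 𝔭).submonoid) := by
    intro A 𝔭 B φ hφ
    by_cases hiso : IsIso φ
    · rw [show Div F φ = 1 from isIsometry_of_isIso F hP φ,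
        show Div F₂ (Ψ.functor.map φ) = 1 from isIsometry_of_isIso F₂ hP₂ _]
      exact ⟨fun _ => one_mem _, fun _ => one_mem _⟩
    have hst : IsStep F φ := ⟨hφ.2, hiso⟩
    have hst₂ : IsStep F₂ (Ψ.functor.map φ) := hstep φ hst
    -- the forward implication, for every prime
    have fwd : ∀ 𝔮 : Primes (Φ.obj (op (baseObj F A))), Div F φ ∈ 𝔮.carrier →
        Div F₂ (Ψ.functor.map φ) ∈ (e A 𝔮).carrier := by
      intro 𝔮 hφ𝔮
      have hφp : IsPrimaryPreStep F φ := ⟨hφ.2, hφ𝔮.1⟩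
      -- a primary step `ε : E → A` in the prime `𝔮`; then `φ ∘ ε` is primary
      obtain ⟨E, ε, hε, hε𝔮⟩ := exists_isPrimaryPreStep_invDiv_mem hF A 𝔮
      haveI : IsIso (Base F ε) := hε.1.2
      have hεst : IsStep F ε := hε.isStep hP
      have hcomp : IsPrimaryPreStep F (ε ≫ φ) := by
        refine ⟨IsPreStep.comp F hε.1 hφ.2, ?_⟩
        rw [div_comp_of_isLinear ε hφ.2.1, ← pull_invDiv ε hε.1.2, ← map_mul]
        exact (isPrimary_pull_iff (Base F ε) _).mpr
          (((hpf _).isPrimary_mul_iff_exists_common_prime hφ𝔮.1 hε𝔮.1).mpr ⟨𝔮, hφ𝔮, hε𝔮⟩)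
      -- (v. the perfect-type original: `Ψ(ε ≫ φ) = Ψ ε ≫ Ψ φ` is a primary pre-step directly by `hprim`)
      have hc₂ : IsPrimaryPreStep F₂ (Ψ.functor.map ε ≫ Ψ.functor.map φ) := by
        rw [← Functor.map_comp]; exact hprim _ hcomp
      have hφ₂ : IsPrimaryPreStep F₂ (Ψ.functor.map φ) := hprim φ hφp
      -- read off the prime of `Div(Ψ φ)` from the primary composite
      have hΨε : IsPrimaryPreStep F₂ (Ψ.functor.map ε) := hprim ε hε
      haveI : IsIso (Base F₂ (Ψ.functor.map ε)) := hΨε.1.2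
      have hprod : IsPrimary (Div F₂ (Ψ.functor.map φ) * invDiv F₂ (Ψ.functor.map ε) hΨε.1.2) := by
        have h1 := hc₂.2
        rw [div_comp_of_isLinear (Ψ.functor.map ε) hφ₂.1.1, ← pull_invDiv (Ψ.functor.map ε) hΨε.1.2,
          ← map_mul] at h1
        exact (isPrimary_pull_iff (Base F₂ (Ψ.functor.map ε)) _).mp h1
      obtain ⟨𝔮₂, hφ𝔮₂, hε𝔮₂⟩ := ((hpf₂ _).isPrimary_mul_iff_exists_common_prime hφ₂.2
        (isPrimary_invDiv hΨε)).mp hprod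
      have hε' := he A ε hε 𝔮 hε𝔮
      rwa [Primes.eq_of_mem_carrier hε𝔮₂ hε'] at hφ𝔮₂
    constructor
    · intro h
      rcases (𝔭.mem_submonoid_iff' _).mp h with h1 | h1
      · exact absurd h1 (div_ne_one_of_isStep histr hst)
      · exact Submonoid.subset_closure (fwd 𝔭 h1)
    · intro h
      rcases ((e A 𝔭).mem_submonoid_iff' _).mp h with h1 | h1
      · exact absurd h1 (div_ne_one_of_isStep histr₂ hst₂)
      · have hφp : IsPrimaryPreStep F φ := isPrimaryPreStep_of_map Ψ hP hprim' ⟨hpre φ hφ.2, h1.1⟩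
        let 𝔮 : Primes (Φ.obj (op (baseObj F A))) := Quotient.mk _ ⟨_, hφp.2⟩
        have hq : Div F φ ∈ 𝔮.carrier := mem_carrier_mk_of_isPrimary _
        have h3 : e A 𝔮 = e A 𝔭 := Primes.eq_of_mem_carrier (fwd 𝔮 hq) h1
        rw [(e A).injective h3] at hq
        exact Submonoid.subset_closure hq
  refine ⟨e, fun A 𝔭 => ⟨clauseA A 𝔭, clauseB A 𝔭⟩, ?_⟩
  -- uniqueness: clause (b) on primary steps into `A` pins down `e A`
  intro e' he'
  funext A
  refine (H A).unique ?_ (he A)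
  intro E ε hε 𝔭 hε𝔭
  haveI : IsIso (Base F ε) := hε.1.2
  have hΨε := hprim ε hε
  haveI : IsIso (Base F₂ (Ψ.functor.map ε)) := hΨε.1.2
  have hco : IsCoAngularPreStep F ε :=
    ⟨isCoAngular_of_isIsotropic_codomains F ε fun Z _ => histr Z, hε.1⟩
  obtain ⟨y, hy, hyx⟩ := ((he' A 𝔭).2 ε hco).mp ⟨_, Submonoid.subset_closure hε𝔭, pull_invDiv ε hε.1.2⟩
  have hy' : y = invDiv F₂ (Ψ.functor.map ε) hΨε.1.2 :=
    pull_injective_of_isIso Φ₂ (Base F₂ (Ψ.functor.map ε)) (by rw [hyx, pull_invDiv])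
  rcases ((e' A 𝔭).mem_submonoid_iff' y).mp hy with h1 | h1
  · exact absurd (by rw [← hyx, h1, map_one])
      (div_ne_one_of_isStep histr₂ (hstep ε (hε.isStep hP)))
  · exact hy' ▸ h1

end PreFrobenioid

/-! ### Theorem 4.2 (ii) as typed, general case modulo "`C^pf` is a Frobenioid" -/

namespace FrdI.T42

open PreFrobenioidData PreFrobenioid.Perfection

universe w v v' u u'

variable {D₁ : Type u} [Category.{v} D₁] {Φ₁ : D₁ᵒᵖ ⥤ CommMonCat.{w}} {C₁ : Type u'} [Category.{v'} C₁]
  {D₂ : Type u} [Category.{v} D₂] {Φ₂ : D₂ᵒᵖ ⥤ CommMonCat.{w}} {C₂ : Type u'} [Category.{v'} C₂]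
  {F₁ : C₁ ⥤ ElemFrobenioid Φ₁} {F₂ : C₂ ⥤ ElemFrobenioid Φ₂} (Ψ : C₁ ≌ C₂)

/-- The typed hypotheses of Thm. 4.2 are symmetric in the two Frobenioids. [cite: MochizukiFrdI2008, Thm. 4.2 p.77] -/
theorem thm42Setting_symm (hT : Thm42Setting (ofFunctor Φ₁ F₁) (ofFunctor Φ₂ F₂)) :
    Thm42Setting (ofFunctor Φ₂ F₂) (ofFunctor Φ₁ F₁) :=
  ⟨⟨hT.standard.2, hT.standard.1⟩, ⟨hT.isotropic.2, hT.isotropic.1⟩, ⟨hT.notGroupLike.2, hT.notGroupLike.1⟩⟩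

/-- **Theorem 4.2 (ii) AS TYPED (`PreFrobenioidData.Thm42ii`) for arbitrary Frobenioids with `Φ_i`
perf-factorial over bases of FSM-type, GIVEN that the perfections `C_i^pf` are Frobenioids** (`hPf_i`,
cone node Prop. 3.2 (iii)): under `Thm42Setting` there is a unique family of prime bijections `Ψ^Prime_A`
compatible with the zero divisors of co-angular pre-steps out of and into `A`. Steps / pre-steps along `Ψ`,
`Ψ⁻¹`: Thm. 3.4 (ii) (seat abc-iut-L1-t13); primary pre-steps along `Ψ`, `Ψ⁻¹`: Thm. 4.2 (i) through the
perfections (`thm42i_of_isOfFSMType_of_perfection`, for `Ψ` and for `Ψ.symm`); then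
`existsUnique_primesEquiv_family'`. [cite: MochizukiFrdI2008, Thm. 4.2 (ii) p.77] -/
theorem thm42ii_ofFunctor_of_isOfFSMType_of_perfection (hF₁ : PreFrobenioid.IsFrobenioid F₁)
    (hF₂ : PreFrobenioid.IsFrobenioid F₂) (hPf₁ : PreFrobenioid.IsFrobenioid (ops hF₁).toFunctor)
    (hPf₂ : PreFrobenioid.IsFrobenioid (ops hF₂).toFunctor)
    (hpf₁ : Objectwise (fun M _ => IsPerfFactorial M) Φ₁) (hpf₂ : Objectwise (fun M _ => IsPerfFactorial M) Φ₂)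
    (hD₁ : IsOfFSMType D₁) (hD₂ : IsOfFSMType D₂) :
    (ofFunctor Φ₁ F₁).Thm42ii (ofFunctor Φ₂ F₂) Ψ := by
  intro hT
  have hP₁ := hF₁.isPreFrobenioid
  have hP₂ := hF₂.isPreFrobenioid
  obtain ⟨hi₁, hi₂, -, -, -, -⟩ := of_thm42Setting hT
  -- Thm. 4.2 (i) for `Ψ` and for `Ψ⁻¹`: primary pre-steps
  obtain ⟨h₁, -, -, -⟩ := thm42i_of_isOfFSMType_of_perfection Ψ hF₁ hF₂ hPf₁ hPf₂ hpf₁ hpf₂ hD₁ hD₂ hT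
  obtain ⟨h₁', -, -, -⟩ := thm42i_of_isOfFSMType_of_perfection Ψ.symm hF₂ hF₁ hPf₂ hPf₁ hpf₂ hpf₁ hD₂ hD₁
    (thm42Setting_symm hT)
  have hprim : ∀ ⦃X Y : C₁⦄ (φ : X ⟶ Y), PreFrobenioid.IsPrimaryPreStep F₁ φ →
      PreFrobenioid.IsPrimaryPreStep F₂ (Ψ.functor.map φ) := fun _ _ φ hφ => (h₁ φ ⟨hφ.isStep hP₁, hφ⟩).2
  have hprim' : ∀ ⦃X Y : C₂⦄ (φ : X ⟶ Y), PreFrobenioid.IsPrimaryPreStep F₂ φ →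
      PreFrobenioid.IsPrimaryPreStep F₁ (Ψ.inverse.map φ) := fun _ _ φ hφ => (h₁' φ ⟨hφ.isStep hP₂, hφ⟩).2
  obtain ⟨e, he, hu⟩ := PreFrobenioid.existsUnique_primesEquiv_family' Ψ hF₁ hF₂ hi₁ hi₂ hpf₁ hpf₂
    (fun _ _ _ hφ => PreFrobenioidData.isStep_map_of_isOfFSMType (Ψ := Ψ) hF₁ hF₂ hi₁ hi₂ hD₂ hφ)
    (fun _ _ _ hφ => FrdI.isPreStep_map_of_isOfFSMType hF₁ hF₂ hi₁ hi₂ hD₂ Ψ hφ)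
    (fun _ _ _ hφ => FrdI.isPreStep_map_of_isOfFSMType hF₂ hF₁ hi₂ hi₁ hD₁ Ψ.symm hφ) hprim hprim'
  refine ⟨e, fun A 𝔭 => ⟨fun B φ hφ => (he A 𝔭).1 φ ((ofFunctor_isCoAngularPreStep F₁ φ).mp hφ),
    fun B ψ hψ => (he A 𝔭).2 ψ ((ofFunctor_isCoAngularPreStep F₁ ψ).mp hψ)⟩, fun e' he' => hu e' ?_⟩
  intro A 𝔭
  exact ⟨fun B φ hφ => (he' A 𝔭).1 φ ((ofFunctor_isCoAngularPreStep F₁ φ).mpr hφ),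
    fun B ψ hψ => (he' A 𝔭).2 ψ ((ofFunctor_isCoAngularPreStep F₁ ψ).mpr hψ)⟩

end FrdI.T42

end Literature.AlgebraicGeometry.Frobenioids
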